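import Summits.BirchSwinnertonDyer.Rank2.LevelFifteenExactDescent
import Summits.BirchSwinnertonDyer.Rank2.MatsunoAnalyticTwinSymbolParity
import HarnessLib

/-!
# Manin symbols on `Γ₀(15)`, IV: EXACT rational plus symbols `[a/c]⁺` of the newforms of `15A8`

Cell `bsd-rank2` (D-0036), seat `bsd-rank2-eng` GEN 9 (director-bsd g9 ruling (R3): BC5 rung «(★_S) mod T⁸ on 15A8»,
line `star`, crux E1M stmt-BirchSwinnertonDyer-20341; Stage B of the rung). GEN 8's X₂ law `[a/2^m]⁺ − [0]⁺ = k/2`,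
`k ≡ m (mod 2)` is refined to EXACT values through the computable descent of part III:

* `ratPlusSymbol_sub_zero_eq_descent` — for every normalised newform `h ∈ S₂(Γ₀(15))` with rational coefficients there is
  ONE sign `s = ±1` (the sign of `re E₁(h)`) with **`[a/c]⁺_h − [0]⁺_h = s · (descent c d).1 / 2`** for all integers
  `a, b, c, d` with `ad − bc = 1`, `c ≠ 0`, `15 ∣ d` (`[r]⁺ = re{∞,r}/Ω⁺`, `Ω⁺ = 2|re E₁|`, `re E₂ = 0`, part III's
  `{∞, a/c} = {∞, 0} + n₁E₁ + n₂E₂`);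
* `ratPlusSymbol_refFifteen_exact` — for every newform `f` of `[1,1,1,0,0]` (Cremona `15A8`; level `15` by Atkin–Lehner):
  **`[0]⁺_f = −s/8`** (from `[1/2]⁺ = −3[0]⁺`, `a₂ = −1`, and `{∞, 1/2} = {∞, 0} + E₁`) and
  **`[a/c]⁺_f = −s/8 + s·(descent c d).1/2`** — the complete exact table of plus symbols at the cusps prime to `15`, up
  to the single global sign `s`, as a kernel-computable integer function; e.g. `[1/2]⁺ = 3s/8`, `[1/4]⁺ = [3/4]⁺ = −s/8`.

These are the exact inputs of the Mazur–Tate Riemann sums of `L₂(15A8)` (`msdMeasure f α (m+1) a =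
α^{−(m+1)}[a/2^{m+1}]⁺ − α^{−(m+2)}[a/2^m]⁺`); the sign `s` drops out of every statement «modulo `2` up to a unit».

THEOREMS ONLY (no definition, no named fact, no `sorry`). PARTITION: none — r_an ≥ 2, summit axis S0; TWIN (D-0056): n/a.
B1 honesty: finite modular-symbol linear algebra at level `15`; nothing here reads an analytic rank; no S0 motion.

References: B. Mazur, J. Tate, J. Teitelbaum, *Invent. Math.* 84 (1986) §I.4, §I.8, §I.10 [MazurTateTeitelbaum1986Invent];
J. E. Cremona, *Algorithms for modular elliptic curves* (1997) §2.8, Table 1 (15A) [CremonaAlgorithms1997];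
Ju. I. Manin, *Izv. Akad. Nauk SSSR* 36 (1972) Thm. 1.6 [Manin1972].
-/

noncomputable section

open scoped MatrixGroups ModularForm

open CongruenceSubgroup Matrix.SpecialLinearGroup ModularGroup Complex
open Literature.NumberTheory.EllipticCurves Literature.NumberTheory.EllipticCurves.ModularForms

namespace Summit.BirchSwinnertonDyer.Rank2.LevelFifteen

/-! ### §1 `[a/c]⁺ − [0]⁺ = s·n₁/2` with the EXACT `n₁ = (descent c d).1` -/

/-- **Exact level-15 symbol law.** For a normalised newform `h ∈ S₂(Γ₀(15))` with rational coefficients there is a sign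
`s ∈ {1, −1}` (that of `re E₁(h)`) such that for all integers `a, b, c, d` with `ad − bc = 1`, `c ≠ 0`, `15 ∣ d`:
`[a/c]⁺_h = [0]⁺_h + s·(descent c d).1/2`. [cite: MazurTateTeitelbaum1986Invent, §I.8] [cite: Manin1972, Thm. 1.6] -/
theorem ratPlusSymbol_sub_zero_eq_descent (h : CuspForm (Gamma0 15) 2) (hf : IsNewform0 h) (hQ : coeffField h = ⊥) :
    ∃ s : ℤ, (s = 1 ∨ s = -1) ∧ ∀ (a b c d : ℤ), a * d - b * c = 1 → c ≠ 0 → (15 : ℤ) ∣ d →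
      ratPlusSymbol h ((a : ℚ) / (c : ℚ)) = ratPlusSymbol h 0 + ((s * (descent c d).1 : ℤ) : ℚ) / 2 := by
  have hreal : ∀ n, (cuspCoeff h n).im = 0 := cuspCoeff_im_eq_zero_of_coeffField_eq_bot hQ
  have hh : h ≠ 0 := hf.ne_zero
  have hE := E₁_ne_zero h hreal hh
  have hre : (E₁ h).re ≠ 0 := by
    intro h0; apply hE; exact Complex.ext (by simpa using h0) (by simpa using E₁_im h hreal)
  have hplus : ∀ r : ℚ, normalizedPlusSymbol h r = (modularSymbol h r).re / plusPeriod h := fun r ↦ by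
    rw [normalizedPlusSymbol, plusSymbol_eq_re_of h (modularSymbol_neg_eq_conj_holds h) hreal r, Complex.ofReal_re]
  -- the sign of `re E₁`
  obtain ⟨s, hs, habs⟩ : ∃ s : ℤ, (s = 1 ∨ s = -1) ∧ |(E₁ h).re| = s * (E₁ h).re := by
    rcases lt_or_gt_of_ne hre with hneg | hpos
    · exact ⟨-1, Or.inr rfl, by rw [abs_of_neg hneg]; push_cast; ring⟩
    · exact ⟨1, Or.inl rfl, by rw [abs_of_pos hpos]; push_cast; ring⟩
  have hs2 : (s : ℝ) * s = 1 := by rcases hs with rfl | rfl <;> norm_num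
  refine ⟨s, hs, fun a b c d hdet hc h15 ↦ ?_⟩
  have hsym := modularSymbol_eq_modularSymbol_zero_add h a b c d hdet hc h15
  -- real parts: `re{∞, a/c} = re{∞, 0} + n₁·re E₁`
  have hreal_parts : (modularSymbol h ((a : ℚ) / (c : ℚ))).re = (modularSymbol h 0).re + (descent c d).1 * (E₁ h).re := by
    rw [hsym]
    simp only [Complex.add_re, Complex.mul_re, Complex.intCast_re, Complex.intCast_im, E₂_re h hreal,
      E₁_im h hreal, mul_zero, sub_zero, zero_mul, add_zero]
  have e1 := ratCast_ratPlusSymbol_holds hf hQ ((a : ℚ) / (c : ℚ))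
  have e0 := ratCast_ratPlusSymbol_holds hf hQ 0
  have key : ((ratPlusSymbol h ((a : ℚ) / (c : ℚ)) : ℚ) : ℝ) =
      ratPlusSymbol h 0 + (((s * (descent c d).1 : ℤ) : ℚ) : ℝ) / 2 := by
    rw [e1, e0, hplus, hplus, hreal_parts, plusPeriod_eq h hreal hE, habs]
    rcases hs with rfl | rfl
    · push_cast
      field_simp
    · push_cast
      field_simp
      ring
  exact_mod_cast key

/-! ### §2 The newforms of `15A8`: `[0]⁺ = −s/8` and the exact table -/

/-- **Exact plus symbols of `15A8`.** For every newform `f` (on any `Γ₀(N)`; the level is `15` by Atkin–Lehner at the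
squarefree conductor `15`) of the reference curve `[1,1,1,0,0]` there is a sign `s ∈ {1, −1}` with
`[0]⁺_f = −s/8` and `[a/c]⁺_f = −s/8 + s·(descent c d).1/2` for all `a, b, c, d ∈ ℤ` with `ad − bc = 1`, `c ≠ 0`, `15 ∣ d`.
(`[1/2]⁺ = −3[0]⁺` by the Hecke relation at `2` with `a₂ = −1`, and `[1/2]⁺ = [0]⁺ + s/2` by §1 with
`descent 2 15 = (1, 0)`, so `−4[0]⁺ = s/2`.) [cite: MazurTateTeitelbaum1986Invent, §I.4 (4.2), §I.8] [cite: CremonaAlgorithms1997, Table 1 (15A)] -/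
theorem ratPlusSymbol_refFifteen_exact ⦃N : ℕ⦄ [NeZero N] (f : CuspForm (Gamma0 N) 2)
    (hW : IsNewformOf (⟨1, 1, 1, 0, 0⟩ : WeierstrassCurve ℚ) f) :
    ∃ s : ℤ, (s = 1 ∨ s = -1) ∧ ratPlusSymbol f 0 = -(s : ℚ) / 8 ∧
      ∀ (a b c d : ℤ), a * d - b * c = 1 → c ≠ 0 → (15 : ℤ) ∣ d →
        ratPlusSymbol f ((a : ℚ) / (c : ℚ)) = -(s : ℚ) / 8 + ((s * (descent c d).1 : ℤ) : ℚ) / 2 := by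
  haveI : (⟨1, 1, 1, 0, 0⟩ : WeierstrassCurve ℚ).IsElliptic := refFifteen_isElliptic
  have hsq : Squarefree ((⟨1, 1, 1, 0, 0⟩ : WeierstrassCurve ℚ).conductorNorm ℤ) := by
    rw [refFifteen_conductorNorm, show (15 : ℕ) = 3 * 5 by norm_num, Nat.squarefree_mul (by norm_num)]
    exact ⟨Nat.prime_three.prime.squarefree, Nat.prime_five.prime.squarefree⟩
  have hN : N = 15 := (hW.level_eq_conductorNorm_of_squarefree hsq).trans refFifteen_conductorNorm
  subst hN
  obtain ⟨s, hs, hlaw⟩ := ratPlusSymbol_sub_zero_eq_descent f hW.1 hW.coeffField_eq_bot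
  have hhalf := ratPlusSymbol_half_eq f hW
  have hlaw2 := hlaw 1 7 2 15 (by norm_num) (by norm_num) ⟨1, by norm_num⟩
  rw [descent_samples.1] at hlaw2
  have h12 : ((1 : ℤ) : ℚ) / ((2 : ℤ) : ℚ) = 1 / 2 := by norm_num
  rw [h12, hhalf] at hlaw2
  have h0 : ratPlusSymbol f 0 = -(s : ℚ) / 8 := by
    push_cast at hlaw2
    linarith
  refine ⟨s, hs, h0, fun a b c d hdet hc h15 ↦ ?_⟩
  rw [hlaw a b c d hdet hc h15, h0]

/-- The dyadic cusps of depth `2`: `[1/4]⁺ = [3/4]⁺ = −s/8 = [0]⁺` and `[1/2]⁺ = 3s/8` for the newforms of `15A8`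
(`descent 4 15 = (0, −1)`, `descent 4 (−15) = (0, 1)` — kernel evaluation — and `descent 2 15 = (1, 0)`).
[cite: CremonaAlgorithms1997, §2.8] -/
theorem ratPlusSymbol_refFifteen_depth_two ⦃N : ℕ⦄ [NeZero N] (f : CuspForm (Gamma0 N) 2)
    (hW : IsNewformOf (⟨1, 1, 1, 0, 0⟩ : WeierstrassCurve ℚ) f) :
    ∃ s : ℤ, (s = 1 ∨ s = -1) ∧ ratPlusSymbol f 0 = -(s : ℚ) / 8 ∧ ratPlusSymbol f (1 / 2) = 3 * (s : ℚ) / 8 ∧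
      ratPlusSymbol f (1 / 4) = -(s : ℚ) / 8 ∧ ratPlusSymbol f (3 / 4) = -(s : ℚ) / 8 := by
  obtain ⟨s, hs, h0, hlaw⟩ := ratPlusSymbol_refFifteen_exact f hW
  have h2 := hlaw 1 7 2 15 (by norm_num) (by norm_num) ⟨1, by norm_num⟩
  have h4 := hlaw 1 (-4) 4 (-15) (by norm_num) (by norm_num) ⟨-1, by norm_num⟩
  have h34 := hlaw 3 11 4 15 (by norm_num) (by norm_num) ⟨1, by norm_num⟩
  have d2 : descent 2 15 = (1, 0) := descent_samples.1
  have d4 : descent 4 (-15) = (0, 1) := by decide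
  have d34 : descent 4 15 = (0, -1) := descent_samples.2.1
  rw [d2] at h2; rw [d4] at h4; rw [d34] at h34
  refine ⟨s, hs, h0, ?_, ?_, ?_⟩
  · have e : ((1 : ℤ) : ℚ) / ((2 : ℤ) : ℚ) = 1 / 2 := by norm_num
    rw [e] at h2; rw [h2]; push_cast; ring
  · have e : ((1 : ℤ) : ℚ) / ((4 : ℤ) : ℚ) = 1 / 4 := by norm_num
    rw [e] at h4; rw [h4]; push_cast; ring
  · have e : ((3 : ℤ) : ℚ) / ((4 : ℤ) : ℚ) = 3 / 4 := by norm_num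
    rw [e] at h34; rw [h34]; push_cast; ring

end Summit.BirchSwinnertonDyer.Rank2.LevelFifteen

end
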